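import Summits.Parity.GeneralizedHardyLittlewood.Theorems.LiouvilleShiftedTablesEngineToPairsDefs
import Summits.Parity.GeneralizedHardyLittlewood.Theses.LiouvilleShiftedTables
import Literature.NumberTheory.Sieve.DivisorPowerSums
import Literature.NumberTheory.LFunctions.LiouvilleSumClassicalBound

/-!
# Type-I budget from `BVLiouville` (stub `stub_TI_of_BV` of line `Sketch`, crux `EngineToPairs`), part 1:
# the inner Type-I sum of `shiftWeight h` is `λ` along one arithmetic progression

Support file for the stub `stub_TI_of_BV : BVLiouville → TIBudget` of the skeleton of line `Sketch`
(stmt-Parity-14659; vocabulary: `Theorems/LiouvilleShiftedTablesEngineToPairsDefs.lean`).  Theorems only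
(no new objects): the per-modulus "worst pair" is produced by an existence statement (`exists_worst`).

For `(q, h) = 1`, `m ≥ 1` and an interval `[a, b]`, the inner Type-I sum of the family `shiftWeight h`,
`S = ∑_{n ∈ [a,b], x/2 < mn ≤ x} 1[mn ≡ h (q)] · λ(mn − h)`, is `λ` summed over the set `K = {mn − h}`,
which is a segment of ONE residue class modulo `d = qm` contained in `[0, x]`: modulo `q` the class of
`mn − h` is `0`, modulo `m` it is `−h`, and `(q, m) = 1` is forced by `(q, h) = 1`; between two elements of
`K` every integer of the class is again in `K`.  A segment `{dt + c : T₁ ≤ t ≤ T₂}` of a class is the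
difference of two initial segments `{dt + c : 1 ≤ t ≤ N}` up to the term `t = 0`, whence
`|S| ≤ 2 G + 1` for any common bound `G` of the sums `|∑_{t=1}^{N} λ(dt + c)|`, `0 ≤ c < d`, `N ≤ x/d`.

* `abs_sum_Icc_le` — a segment of a progression against two initial segments;
* `exists_worst` — for a scale `x ≥ 0`, argmax choice functions `d ↦ (c_d, N_d)` (residue `c_d < d`, height
  `N_d ≤ ⌊x/d⌋`) realising `G_x(d) = max_{c < d, N ≤ x/d} |∑_{t=1}^{N} λ(dt + c)|`, with `0 ≤ G_x(d) ≤ x/d`;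
* `abs_sum_liouville_le_of_convex` — `|∑_{k ∈ S} λ(k)| ≤ 2 G + 1` for a class-convex set `S ⊆ [0, x]`
  inside one class modulo `d`;
* `abs_inner_le` — the same bound for the inner Type-I sum of `shiftWeight h` at the modulus `d = qm`.

Part 2 (`…TIOfBVPart2.lean`) does the multiplicity / Cauchy–Schwarz bookkeeping over `d = qm` and applies
`BVLiouville` once with the argmax choice functions.
-/

noncomputable section

namespace Summit.Parity.GeneralizedHardyLittlewood.Theorems.EngineToPairs.TIOfBV

open Finset Real ArithmeticFunction
open Literature.NumberTheory.LFunctions.LiouvilleSum (abs_liouville_le_one)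

/-! ### `λ` along a progression: trivial bound, segments, the worst pair per modulus -/

/-- The trivial bound `|∑_{t=1}^{N} λ(dt + c)| ≤ N`. [folklore] -/
theorem abs_sum_Icc_one_le (d c N : ℕ) : |∑ t ∈ Icc 1 N, (liouville (d * t + c) : ℝ)| ≤ N := by
  refine (abs_sum_le_sum_abs _ _).trans ?_
  calc ∑ t ∈ Icc 1 N, |(liouville (d * t + c) : ℝ)| ≤ ∑ _t ∈ Icc 1 N, (1 : ℝ) :=
        sum_le_sum fun t _ => abs_liouville_le_one _
    _ = N := by simp

/-- A segment of a progression against two initial segments: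
`|∑_{T₁ ≤ t ≤ T₂} λ(dt + c)| ≤ |∑_{t=1}^{T₂} λ(dt + c)| + |∑_{t=1}^{T₁ − 1} λ(dt + c)| + 1` (the `1` accounts
for the term `t = 0` when `T₁ = 0`; truncated subtraction). [folklore] -/
theorem abs_sum_Icc_le (d c T₁ T₂ : ℕ) :
    |∑ t ∈ Icc T₁ T₂, (liouville (d * t + c) : ℝ)| ≤
      |∑ t ∈ Icc 1 T₂, (liouville (d * t + c) : ℝ)| +
        |∑ t ∈ Icc 1 (T₁ - 1), (liouville (d * t + c) : ℝ)| + 1 := by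
  set F : ℕ → ℝ := fun N => ∑ t ∈ Icc 1 N, (liouville (d * t + c) : ℝ) with hF
  have h0 : 0 ≤ |F T₂| + |F (T₁ - 1)| := by positivity
  rcases lt_or_ge T₂ T₁ with hlt | hle
  · rw [Finset.Icc_eq_empty (by omega), sum_empty, abs_zero]
    linarith
  rcases Nat.eq_zero_or_pos T₁ with rfl | hT₁
  · -- `Icc 0 T₂ = {0} ∪ Icc 1 T₂`
    have hsplit : ∑ t ∈ Icc 0 T₂, (liouville (d * t + c) : ℝ) = (liouville (d * 0 + c) : ℝ) + F T₂ := by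
      rw [show (Icc 0 T₂ : Finset ℕ) = insert 0 (Icc 1 T₂) by
        ext t; simp only [mem_Icc, mem_insert]; omega, sum_insert (by simp)]
    rw [hsplit, Nat.zero_sub]
    calc |(liouville (d * 0 + c) : ℝ) + F T₂| ≤ |(liouville (d * 0 + c) : ℝ)| + |F T₂| := abs_add_le _ _
      _ ≤ 1 + |F T₂| := by gcongr; exact abs_liouville_le_one _
      _ ≤ _ := by linarith [abs_nonneg (F 0)]
  · -- `1 ≤ T₁ ≤ T₂`: `Icc T₁ T₂ = Ioc (T₁ - 1) T₂` and `Icc 1 N = Ioc 0 N`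
    have hsplit : F T₂ = F (T₁ - 1) + ∑ t ∈ Icc T₁ T₂, (liouville (d * t + c) : ℝ) := by
      simp only [hF]
      rw [show (Icc 1 T₂ : Finset ℕ) = Ioc 0 T₂ from rfl,
        show (Icc 1 (T₁ - 1) : Finset ℕ) = Ioc 0 (T₁ - 1) from rfl,
        show (Icc T₁ T₂ : Finset ℕ) = Ioc (T₁ - 1) T₂ by ext t; simp only [mem_Icc, mem_Ioc]; omega]
      exact (sum_Ioc_consecutive _ (Nat.zero_le _) (by omega)).symm
    rw [show ∑ t ∈ Icc T₁ T₂, (liouville (d * t + c) : ℝ) = F T₂ - F (T₁ - 1) by rw [hsplit]; ring]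
    calc |F T₂ - F (T₁ - 1)| ≤ |F T₂| + |F (T₁ - 1)| := abs_sub _ _
      _ ≤ _ := by linarith

/-- **The worst residue and height per modulus.**  For a scale `x ≥ 0` there are choice functions
`d ↦ (c_d, N_d)` with `c_d < d`, `N_d ≤ ⌊x/d⌋` (for `d ≥ 1`) such that
`G(d) = |∑_{t=1}^{N_d} λ(dt + c_d)|` dominates `|∑_{t=1}^{N} λ(dt + c)|` for all `c < d`, `N ≤ ⌊x/d⌋`
(a maximum over a finite nonempty set of pairs), and `0 ≤ G(d) ≤ x/d`. [folklore] -/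
theorem exists_worst {x : ℝ} (hx : 0 ≤ x) :
    ∃ P : ℕ → ℕ × ℕ, ∃ G : ℕ → ℝ,
      (∀ d, G d = |∑ t ∈ Icc 1 (P d).2, (liouville (d * t + (P d).1) : ℝ)|) ∧
      (∀ d, 1 ≤ d → (P d).1 < d ∧ (P d).2 ≤ ⌊x / d⌋₊) ∧
      (∀ d, 1 ≤ d → ∀ c N : ℕ, c < d → N ≤ ⌊x / d⌋₊ →
        |∑ t ∈ Icc 1 N, (liouville (d * t + c) : ℝ)| ≤ G d) ∧
      (∀ d, 0 ≤ G d) ∧ (∀ d, 1 ≤ d → G d ≤ x / d) := by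
  -- the finite set of admissible pairs and the argmax on it
  have key : ∀ d : ℕ, ∃ p : ℕ × ℕ, 1 ≤ d →
      (p ∈ range d ×ˢ range (⌊x / d⌋₊ + 1) ∧ ∀ p' ∈ range d ×ˢ range (⌊x / d⌋₊ + 1),
        |∑ t ∈ Icc 1 p'.2, (liouville (d * t + p'.1) : ℝ)| ≤
          |∑ t ∈ Icc 1 p.2, (liouville (d * t + p.1) : ℝ)|) := by
    intro d
    rcases Nat.eq_zero_or_pos d with rfl | hd
    · exact ⟨(0, 0), fun h => absurd h (by norm_num)⟩
    · obtain ⟨p, hp, hmax⟩ := exists_max_image (range d ×ˢ range (⌊x / d⌋₊ + 1))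
        (fun p : ℕ × ℕ => |∑ t ∈ Icc 1 p.2, (liouville (d * t + p.1) : ℝ)|)
        ⟨(0, 0), mem_product.2 ⟨mem_range.2 hd, mem_range.2 (Nat.succ_pos _)⟩⟩
      exact ⟨p, fun _ => ⟨hp, hmax⟩⟩
  choose P hP using key
  have hmem : ∀ d, 1 ≤ d → (P d).1 < d ∧ (P d).2 ≤ ⌊x / d⌋₊ := fun d hd => by
    have h := (hP d hd).1
    rw [mem_product, mem_range, mem_range] at h
    exact ⟨h.1, Nat.lt_succ_iff.1 h.2⟩
  refine ⟨P, fun d => |∑ t ∈ Icc 1 (P d).2, (liouville (d * t + (P d).1) : ℝ)|, fun d => rfl, hmem,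
    fun d hd c N hc hN => ?_, fun d => abs_nonneg _, fun d hd => ?_⟩
  · exact (hP d hd).2 (c, N) (mem_product.2 ⟨mem_range.2 hc, mem_range.2 (Nat.lt_succ_of_le hN)⟩)
  · calc |∑ t ∈ Icc 1 (P d).2, (liouville (d * t + (P d).1) : ℝ)| ≤ (P d).2 := abs_sum_Icc_one_le _ _ _
      _ ≤ ⌊x / d⌋₊ := by exact_mod_cast (hmem d hd).2
      _ ≤ x / d := Nat.floor_le (by positivity)

/-! ### A class-convex set inside one residue class is a segment of a progression -/

/-- A nonempty finite set `S ⊆ ℕ` whose elements are pairwise congruent modulo `d` and which contains,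
with any two of its elements, every integer of their class between them, is the segment
`{dt + c : ⌊min S/d⌋ ≤ t ≤ ⌊max S/d⌋}`, `c = min S mod d`, of a progression (also for `d = 0`, where
`S` is a singleton and `k / 0 = 0`, `k % 0 = k`). [folklore] -/
theorem eq_image_of_convex {d : ℕ} {S : Finset ℕ} (hS : S.Nonempty)
    (hmod : ∀ k₁ ∈ S, ∀ k₂ ∈ S, k₁ ≡ k₂ [MOD d])
    (hconv : ∀ k₁ ∈ S, ∀ k₂ ∈ S, ∀ k, k₁ ≤ k → k ≤ k₂ → k ≡ k₁ [MOD d] → k ∈ S) :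
    S = (Icc (S.min' hS / d) (S.max' hS / d)).image (fun t => d * t + S.min' hS % d) := by
  set kmin := S.min' hS with hkmin
  set kmax := S.max' hS with hkmax
  have hminS : kmin ∈ S := min'_mem S hS
  have hmaxS : kmax ∈ S := max'_mem S hS
  have hmaxmod : kmax % d = kmin % d := hmod kmax hmaxS kmin hminS
  ext k
  simp only [mem_image, mem_Icc]
  constructor
  · intro hk
    refine ⟨k / d, ⟨Nat.div_le_div_right (min'_le S k hk), Nat.div_le_div_right (le_max' S k hk)⟩, ?_⟩
    have hkmod : k % d = kmin % d := hmod k hk kmin hminS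
    rw [← hkmod]
    exact Nat.div_add_mod k d
  · rintro ⟨t, ⟨ht₁, ht₂⟩, rfl⟩
    refine hconv kmin hminS kmax hmaxS _ ?_ ?_ ?_
    · calc kmin = d * (kmin / d) + kmin % d := (Nat.div_add_mod kmin d).symm
        _ ≤ d * t + kmin % d := by gcongr
    · calc d * t + kmin % d ≤ d * (kmax / d) + kmin % d := by gcongr
        _ = d * (kmax / d) + kmax % d := by rw [hmaxmod]
        _ = kmax := Nat.div_add_mod kmax d
    · show (d * t + kmin % d) % d = kmin % d
      rw [Nat.mul_add_mod_self_left, Nat.mod_mod]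

/-- For a class-convex finite set `S` inside one residue class modulo `d ≥ 1` with `S ⊆ [0, x]`, and any
common bound `G ≥ 0` of `|∑_{t=1}^{N} λ(dt + c)|` over `c < d`, `N ≤ ⌊x/d⌋`:
`|∑_{k ∈ S} λ(k)| ≤ 2 G + 1`. [this line] -/
theorem abs_sum_liouville_le_of_convex {d : ℕ} (hd : 1 ≤ d) {x : ℝ} {S : Finset ℕ}
    (hmod : ∀ k₁ ∈ S, ∀ k₂ ∈ S, k₁ ≡ k₂ [MOD d])
    (hconv : ∀ k₁ ∈ S, ∀ k₂ ∈ S, ∀ k, k₁ ≤ k → k ≤ k₂ → k ≡ k₁ [MOD d] → k ∈ S)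
    (hx : ∀ k ∈ S, (k : ℝ) ≤ x) {G : ℝ} (hG0 : 0 ≤ G)
    (hG : ∀ c N : ℕ, c < d → N ≤ ⌊x / d⌋₊ → |∑ t ∈ Icc 1 N, (liouville (d * t + c) : ℝ)| ≤ G) :
    |∑ k ∈ S, (liouville k : ℝ)| ≤ 2 * G + 1 := by
  rcases S.eq_empty_or_nonempty with rfl | hS
  · rw [sum_empty, abs_zero]; linarith
  set kmin := S.min' hS with hkmin
  set kmax := S.max' hS with hkmax
  have hmaxS : kmax ∈ S := max'_mem S hS
  have hd0 : (0 : ℝ) < d := by exact_mod_cast hd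
  -- re-index the sum along the progression
  have himage := eq_image_of_convex hS hmod hconv
  have hinj : Set.InjOn (fun t => d * t + kmin % d) ↑(Icc (kmin / d) (kmax / d)) := by
    intro t₁ _ t₂ _ h
    have h' : d * t₁ = d * t₂ := by simpa using h
    exact Nat.eq_of_mul_eq_mul_left (by omega) h'
  have hsum : ∑ k ∈ S, (liouville k : ℝ) =
      ∑ t ∈ Icc (kmin / d) (kmax / d), (liouville (d * t + kmin % d) : ℝ) := by
    conv_lhs => rw [himage]
    rw [sum_image hinj]
  rw [hsum]
  -- the two heights are admissible
  have hT₂ : kmax / d ≤ ⌊x / d⌋₊ := by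
    refine Nat.le_floor ?_
    calc ((kmax / d : ℕ) : ℝ) ≤ (kmax : ℝ) / d := Nat.cast_div_le
      _ ≤ x / d := div_le_div_of_nonneg_right (hx kmax hmaxS) hd0.le
  have hT₁ : kmin / d - 1 ≤ ⌊x / d⌋₊ :=
    le_trans (Nat.sub_le _ _) ((Nat.div_le_div_right (min'_le S kmax hmaxS)).trans hT₂)
  have hc : kmin % d < d := Nat.mod_lt _ (by omega)
  calc |∑ t ∈ Icc (kmin / d) (kmax / d), (liouville (d * t + kmin % d) : ℝ)|
      ≤ |∑ t ∈ Icc 1 (kmax / d), (liouville (d * t + kmin % d) : ℝ)| +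
          |∑ t ∈ Icc 1 (kmin / d - 1), (liouville (d * t + kmin % d) : ℝ)| + 1 := abs_sum_Icc_le _ _ _ _
    _ ≤ G + G + 1 := by gcongr <;> exact hG _ _ hc ‹_›
    _ = 2 * G + 1 := by ring

/-! ### The inner Type-I sum of `shiftWeight h` -/

/-- If `h < mn`, `mn ≡ h (mod q)` and `(q, h) = 1` then `(q, m) = 1` (a common divisor of `q` and `m`
divides `mn − (mn − h) = h`). [folklore] -/
theorem coprime_of_lt_of_modEq {h q m n : ℕ} (hq : Nat.Coprime q h) (hlt : h < m * n)
    (hmn : m * n ≡ h [MOD q]) : Nat.Coprime q m := by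
  have hdvd : q ∣ m * n - h := (Nat.modEq_iff_dvd' hlt.le).1 hmn.symm
  have hq1 : Nat.gcd q h = 1 := Nat.coprime_iff_gcd_eq_one.mp hq
  rw [Nat.coprime_iff_gcd_eq_one, ← Nat.dvd_one, ← hq1]
  refine Nat.dvd_gcd (Nat.gcd_dvd_left q m) ?_
  have h1 : Nat.gcd q m ∣ m * n - h := (Nat.gcd_dvd_left q m).trans hdvd
  have h2 : Nat.gcd q m ∣ m * n := (Nat.gcd_dvd_right q m).trans (dvd_mul_right m n)
  have h3 : Nat.gcd q m ∣ m * n - (m * n - h) := Nat.dvd_sub h2 h1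
  rwa [Nat.sub_sub_self hlt.le] at h3

/-- For a finite set `R` of `n` with `h < mn ≡ h (mod q)`, `(q, h) = 1`, the numbers `mn − h`, `n ∈ R`,
are pairwise congruent modulo `qm` (class `0` modulo `q`, class `−h` modulo `m`, `(q, m) = 1`).
[folklore] -/
theorem image_modEq {h q m : ℕ} (hq : Nat.Coprime q h) {R : Finset ℕ}
    (hR : ∀ n ∈ R, h < m * n ∧ m * n ≡ h [MOD q]) :
    ∀ k₁ ∈ R.image (fun n : ℕ => m * n - h), ∀ k₂ ∈ R.image (fun n : ℕ => m * n - h),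
      k₁ ≡ k₂ [MOD q * m] := by
  simp only [mem_image]
  rintro _ ⟨n₁, hn₁, rfl⟩ _ ⟨n₂, hn₂, rfl⟩
  obtain ⟨hlt₁, hmod₁⟩ := hR n₁ hn₁
  obtain ⟨hlt₂, hmod₂⟩ := hR n₂ hn₂
  have hdvd₁ : q ∣ m * n₁ - h := (Nat.modEq_iff_dvd' hlt₁.le).1 hmod₁.symm
  have hdvd₂ : q ∣ m * n₂ - h := (Nat.modEq_iff_dvd' hlt₂.le).1 hmod₂.symm
  refine (Nat.modEq_and_modEq_iff_modEq_mul (coprime_of_lt_of_modEq hq hlt₁ hmod₁)).1 ⟨?_, ?_⟩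
  · exact (Nat.modEq_zero_iff_dvd.2 hdvd₁).trans (Nat.modEq_zero_iff_dvd.2 hdvd₂).symm
  · refine Nat.ModEq.add_right_cancel' h ?_
    rw [Nat.sub_add_cancel hlt₁.le, Nat.sub_add_cancel hlt₂.le]
    exact (Nat.modEq_zero_iff_dvd.2 (dvd_mul_right m n₁)).trans
      (Nat.modEq_zero_iff_dvd.2 (dvd_mul_right m n₂)).symm

/-- If moreover `R` contains, with `n₁ ≤ n₂`, every `n ∈ [n₁, n₂]` with `mn ≡ h (mod q)`, then
`{mn − h : n ∈ R}` is class-convex modulo `qm`: an integer of the class between two elements is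
`mn − h` with `n = (k + h)/m ∈ R`. [folklore] -/
theorem image_convex {h q m : ℕ} {R : Finset ℕ} (hR : ∀ n ∈ R, h < m * n ∧ m * n ≡ h [MOD q])
    (hRconv : ∀ n₁ ∈ R, ∀ n₂ ∈ R, ∀ n, n₁ ≤ n → n ≤ n₂ → m * n ≡ h [MOD q] → n ∈ R) :
    ∀ k₁ ∈ R.image (fun n : ℕ => m * n - h), ∀ k₂ ∈ R.image (fun n : ℕ => m * n - h), ∀ k,
      k₁ ≤ k → k ≤ k₂ → k ≡ k₁ [MOD q * m] → k ∈ R.image (fun n : ℕ => m * n - h) := by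
  simp only [mem_image]
  rintro _ ⟨n₁, hn₁, rfl⟩ _ ⟨n₂, hn₂, rfl⟩ k hk₁ hk₂ hmod
  obtain ⟨hlt₁, hmod₁⟩ := hR n₁ hn₁
  obtain ⟨hlt₂, -⟩ := hR n₂ hn₂
  have hdvd₁ : q ∣ m * n₁ - h := (Nat.modEq_iff_dvd' hlt₁.le).1 hmod₁.symm
  have hm : 0 < m := Nat.pos_of_ne_zero (by rintro rfl; simp at hlt₁)
  -- `m ∣ k + h`
  have hmodm : k + h ≡ m * n₁ [MOD m] := by
    have := (hmod.of_mul_left q).add_right h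
    rwa [Nat.sub_add_cancel hlt₁.le] at this
  obtain ⟨n, hn⟩ : m ∣ k + h :=
    Nat.modEq_zero_iff_dvd.1 (hmodm.trans (Nat.modEq_zero_iff_dvd.2 (dvd_mul_right m n₁)))
  -- `n₁ ≤ n ≤ n₂` and `mn ≡ h (mod q)`
  have hn₁n : n₁ ≤ n := Nat.le_of_mul_le_mul_left (by omega) hm
  have hnn₂ : n ≤ n₂ := Nat.le_of_mul_le_mul_left (by omega) hm
  have hmodq : m * n ≡ h [MOD q] := by
    rw [← hn]
    have hk0 : k ≡ 0 [MOD q] := (hmod.of_mul_right m).trans (Nat.modEq_zero_iff_dvd.2 hdvd₁)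
    simpa using hk0.add_right h
  exact ⟨n, hRconv n₁ hn₁ n₂ hn₂ n hn₁n hnn₂ hmodq, by omega⟩

/-- **The inner Type-I sum of `shiftWeight h` against `λ` in progressions**: for `(q, h) = 1`, `q, m ≥ 1`,
`x ≥ 2h`, an interval `[a, b]`, and any common bound `G ≥ 0` of `|∑_{t=1}^{N} λ(qm·t + c)|` over
`c < qm`, `N ≤ ⌊x/(qm)⌋`: `|∑_{n ∈ [a,b], x/2 < mn ≤ x} shiftWeight h q (mn)| ≤ 2 G + 1`. [this line] -/
theorem abs_inner_le {h q m : ℕ} (hq : Nat.Coprime q h) (hq1 : 1 ≤ q) (hm : 1 ≤ m) {x : ℝ}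
    (hx : 2 * (h : ℝ) ≤ x) (a b : ℕ) {G : ℝ} (hG0 : 0 ≤ G)
    (hG : ∀ c N : ℕ, c < q * m → N ≤ ⌊x / (q * m : ℕ)⌋₊ →
      |∑ t ∈ Icc 1 N, (liouville (q * m * t + c) : ℝ)| ≤ G) :
    |∑ n ∈ (Icc a b).filter (fun n : ℕ => x / 2 < (m : ℝ) * n ∧ (m : ℝ) * n ≤ x),
        shiftWeight h q (m * n)| ≤ 2 * G + 1 := by
  -- the class-filtered range `R` and the facts about its elements
  set R : Finset ℕ := ((Icc a b).filter (fun n : ℕ => x / 2 < (m : ℝ) * n ∧ (m : ℝ) * n ≤ x)).filter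
    (fun n : ℕ => m * n ≡ h [MOD q]) with hRdef
  have hmemR : ∀ {n : ℕ}, n ∈ R ↔
      (a ≤ n ∧ n ≤ b) ∧ (x / 2 < (m : ℝ) * n ∧ (m : ℝ) * n ≤ x) ∧ m * n ≡ h [MOD q] := by
    intro n; simp [hRdef, and_assoc]
  have hlt : ∀ {n : ℕ}, n ∈ R → h < m * n := fun {n} hn => by
    have h1 := (hmemR.1 hn).2.1.1
    have h2 : (h : ℝ) < (m : ℝ) * n := by linarith
    exact_mod_cast h2
  have hR : ∀ n ∈ R, h < m * n ∧ m * n ≡ h [MOD q] := fun n hn => ⟨hlt hn, (hmemR.1 hn).2.2⟩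
  have hRconv : ∀ n₁ ∈ R, ∀ n₂ ∈ R, ∀ n, n₁ ≤ n → n ≤ n₂ → m * n ≡ h [MOD q] → n ∈ R := by
    intro n₁ hn₁ n₂ hn₂ n h₁ h₂ hmodq
    obtain ⟨⟨ha₁, -⟩, ⟨hx₁, -⟩, -⟩ := hmemR.1 hn₁
    obtain ⟨⟨-, hb₂⟩, ⟨-, hx₂⟩, -⟩ := hmemR.1 hn₂
    refine hmemR.2 ⟨⟨ha₁.trans h₁, h₂.trans hb₂⟩, ⟨?_, ?_⟩, hmodq⟩
    · calc x / 2 < (m : ℝ) * n₁ := hx₁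
        _ ≤ (m : ℝ) * n := by exact_mod_cast Nat.mul_le_mul_left m h₁
    · calc (m : ℝ) * n ≤ (m : ℝ) * n₂ := by exact_mod_cast Nat.mul_le_mul_left m h₂
        _ ≤ x := hx₂
  -- the inner sum is `λ` summed over the image `{mn − h : n ∈ R}`
  have hinj : Set.InjOn (fun n : ℕ => m * n - h) ↑R := by
    intro n₁ hn₁ n₂ hn₂ he
    have h₁ := hlt hn₁
    have h₂ := hlt hn₂
    have he' : m * n₁ - h = m * n₂ - h := he
    exact Nat.eq_of_mul_eq_mul_left (show 0 < m by omega) (by omega)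
  have hsum : ∑ n ∈ (Icc a b).filter (fun n : ℕ => x / 2 < (m : ℝ) * n ∧ (m : ℝ) * n ≤ x),
      shiftWeight h q (m * n) = ∑ k ∈ R.image (fun n : ℕ => m * n - h), (liouville k : ℝ) := by
    symm
    rw [sum_image hinj, hRdef, sum_filter]
    rfl
  rw [hsum]
  refine abs_sum_liouville_le_of_convex (Nat.mul_pos hq1 hm) (image_modEq hq hR) (image_convex hR hRconv)
    ?_ hG0 hG
  simp only [mem_image]
  rintro _ ⟨n, hn, rfl⟩
  have h1 := hlt hn
  have h2 := (hmemR.1 hn).2.1.2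
  calc ((m * n - h : ℕ) : ℝ) ≤ ((m * n : ℕ) : ℝ) := by exact_mod_cast Nat.sub_le _ _
    _ ≤ x := by push_cast; exact h2

end Summit.Parity.GeneralizedHardyLittlewood.Theorems.EngineToPairs.TIOfBV

/-! ### Anchor -/

namespace Summit.Parity.GeneralizedHardyLittlewood.Theorems.EngineToPairs

/-- Anchor of this helper part (registered sub-goal of `stub_TI_of_BV`): the trivial bound for `λ` along
an initial segment of a progression, `|∑_{t=1}^{N} λ(dt + c)| ≤ N`. [folklore] -/
theorem tiOfBV_part1_anchor :
    ∀ d c N : ℕ, |∑ t ∈ Finset.Icc 1 N, (ArithmeticFunction.liouville (d * t + c) : ℝ)| ≤ N :=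
  TIOfBV.abs_sum_Icc_one_le

end Summit.Parity.GeneralizedHardyLittlewood.Theorems.EngineToPairs

end
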